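import Literature.NumberTheory.Rogawski1990.DepthZeroKappaTransferTypeTwoRamifiedIntrinsicOfBlockLawPm   -- ★ p848727 (F0P3a-p03 (g18)): `stub_T2G_pm_{par}_lat_of_blockLaw`
import Literature.NumberTheory.Automorphic.UnitaryLatticeTreeCountsClassFunction                          -- ★ `ncard_selfDual_fixed_rankOneNot_eq_of_formCongr`; brings ★ `UnitaryLatticeTreeFormTransport` (`…_deep_…`, `…_rankOne_…`)
import Literature.NumberTheory.Rogawski1990.DepthZeroKappaTransferTypeTwoRamifiedDepthDictionary   -- ★ chair F0P3a-p07 (g15): `typeTwo_depthDictionary_{even,odd}_ram` (the m∕N∕τ dictionary)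
import Literature.NumberTheory.Rogawski1990.DepthZeroKappaTransferTypeTwoRamifiedBlockLawArith   -- ★ p848928∕p848956 (F0P3a-p03 (g18)): the per-regime ℂ-identities `BlockLawArith.*_absNorm`
import Literature.NumberTheory.Rogawski1990.DepthZeroKappaTransferTypeTwoRamifiedAnisotropicCellPmB   -- ★ p849655 (A-p16 g33): `BlockLawAniso.zaniso_pm_{even,odd}_B_ram`
import Literature.NumberTheory.Rogawski1990.DepthZeroKappaTransferTypeTwoRamifiedHyperbolicCellPmBOdd   -- ★ F0P3a-p04 (g21): `BlockLawHyp.zhyp_pm_odd_B_ram`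
import HarnessLib

/-!
Copyright: harness tree (hodgecm-mathlib). (Cnt2′) pm-row REGIME-B PAIR CELLS of the (α) block-law skeleton.

# The pm-row regime-B pair cell `stub_Zpair_pm_odd_B`, proved (ODD discriminant depth; the other parity is the twin module)

For a type-(2) elliptic `γ_H = (g, u)` of `U(2) × U(1)` at a tame-ramified CM place `w` (uniformiser `ϖ`,
`σϖ = −ϖ`, `2` a unit), in the regime-B window `m = 2k+3 < N` of the depth dictionary
(`Literature.NumberTheory.Rogawski1990.typeTwo_depthDictionary_{even,odd}_ram`), the self-dual-lattice
fixed-point counts of the TWO literals `P₁·ι(γ₁, ĝ₂)·P₁⁻¹` (anisotropic, `γ₁ ∈ U(diag d)`) and the hyperbolic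
model, for the `pm` similitude classes, satisfy the keeper's JOINT relation
`NhP − NaP = NhM − NaM = ((q−1)q·R − (q+1)q)/2` together with the closed forms of `R` and `NE`
(keyed on the flip predicate `IsSquare (−1 : 𝓀_w) ∨ Even k`).  The two theorems below are the keeper's
(F0P3a-p06 (g16)) skeleton texts `stub_Zpair_pm_even_B` / `stub_Zpair_pm_odd_B` (v2.3) VERBATIM, proved by
composing the per-literal cells `BlockLawHyp.zhyp_pm_{even,odd}_B_ram` (F0P3a-p04 (g21), ★ `…DepthZeroKappaTransferTypeTwoRamifiedHyperbolicCellPmBOdd`) and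
`BlockLawAniso.zaniso_pm_{even,odd}_B_ram` (A-p16 (g33), ★ `…AnisotropicCellPmB`), split on the orientation
predicate `Λ(c) := ∃ z, |z| = 1 ∧ |((tr g_w) − 2·u_w)/(2ϖ^m) − c·z²| < 1` (chair RULING (15)).

References: J. Rogawski, *Automorphic Representations of Unitary Groups in Three Variables*, Annals of
Math. Studies 123 (1990), §4.9 (Prop. 4.9.1, p. 55; Lemma 4.9.3, p. 56); J.-P. Labesse, R. P. Langlands,
*L-indistinguishability for SL(2)*, Canad. J. Math. 31 (1979), §2; R. Kottwitz, *Base change for unit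
elements of Hecke algebras*, Compositio Math. 60 (1986), §3.
-/

set_option autoImplicit false

noncomputable section

open MeasureTheory Measure Set Filter Topology NumberField IsDedekindDomain Matrix Polynomial ValuativeRel
open Literature.NumberTheory.Automorphic Literature.NumberTheory.Automorphic.UnitaryGroup
open Literature.NumberTheory.Automorphic.IntegralReduction Literature.NumberTheory.GaloisRepresentations
open Literature.NumberTheory.NumberFields Literature.NumberTheory.QuadraticForms
open Literature.GroupTheory.SpecificGroups Literature.NumberTheory.Automorphic.UnitaryLatticeTree
open Literature.NumberTheory.Automorphic.HermitianLattice
open scoped Matrix MatrixGroups ValuativeRel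

namespace Literature.NumberTheory.Rogawski1990.BlockLawPair

set_option maxHeartbeats 1600000 in
-- budget only: statement-heavy lattice tokens (as the keeper's skeleton).
/-- **pm-ROW REGIME-B PAIR CELL, ODD `N = 2n+1`** (keeper v2.3 `stub_Zpair_pm_odd_B` VERBATIM): in the window `m = 2k+3`, `n = a+k+1`, `m < 2n+1`, there are `R NE NhP NhM NaP NaM : ℕ` with the two literal counts as in the even case, `R = (q+1)·Σ_{i<a} q^i + q^a`, `NE = 2·q^(a+1)`, and the JOINT relation `NhP − NaP = NhM − NaM = ((q−1)q·R − (q+1)q)/2`.  Proof: as in the even case, split on `Λ(c)`. [cite: Rogawski1990, §4.9 Prop. 4.9.1 p. 55] [cite: LabesseLanglands1979, §2 Lemma 2.1 p. 8] [cite: Kottwitz1986, §3] -/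
theorem zpair_pm_odd_B_ram
    (L : Type) [Field L] [NumberField L] [IsCMField L] (H' : Matrix (Fin 3) (Fin 3) L)
    {v : HeightOneSpectrum (𝓞 ↥(maximalRealSubfield L))}
    (hH' : (H'.map (cmConjRingHom L)).transpose = H') (w : PlacesOver L v)
    (hw : IsCMField.complexConj L • w.1 = w.1) (he : v.asIdeal.ramificationIdx' w.1.asIdeal ≠ 1)
    (hH'w : IsUnit (placeForm H' w.1)) (_hH'i : hH'w.unit ∈ glInt 3 (w.1.adicCompletion L))
    (h2 : IsUnit (2 : 𝒪[(w.1.adicCompletion L)]))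
    (ϖ : w.1.adicCompletion L) (hϖ : Valued.v ϖ = WithZero.exp (-1 : ℤ)) (hσϖ : galAdicCompletionMap (L := L) (IsCMField.complexConj L) hw ϖ = -ϖ)
    (A : GL (Fin 3) (w.1.adicCompletion L)) (hA : A ∈ glInt 3 (w.1.adicCompletion L))
    (hframe : placeForm H' w.1 = (-(placeForm H' w.1).det) • formCongr (galAdicCompletionMap (L := L) (IsCMField.complexConj L) hw) A ((StdForm.antidiagonal 3).over (w.1.adicCompletion L))) :

    ∀ (c : (w.1.adicCompletion L)), Valued.v c ≤ 1 → red c * red (-((placeForm H' w.1)).det) = 1 →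
      ∀ ⦃γH : ((cmDatum L 2 (Matrix.of fun i j : Fin 2 => if i.val + j.val + 1 = 2 then (1 : L) else 0)).Local v × (cmDatum L 1 (Matrix.of fun i j : Fin 1 => if i.val + j.val + 1 = 1 then (1 : L) else 0)).Local v)⦄,
      (∀ i j : Fin 2, Valued.v (((((γH.1.val : GL (Fin 2) (UnitaryGroup.LocalRing L v)).val.map (Pi.evalRingHom (fun w' : PlacesOver L v => w'.1.adicCompletion L) w))) - 1) i j) ≤ Valued.v (ϖ ^ 2)) → Valued.v (finGammaTwo L v γH w - 1) ≤ Valued.v (ϖ ^ 2) → IsLocalGRegular L v γH →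
      (¬ ∃ x : (w.1.adicCompletion L), ((((γH.1.val : GL (Fin 2) (UnitaryGroup.LocalRing L v)).val.map (Pi.evalRingHom (fun w' : PlacesOver L v => w'.1.adicCompletion L) w))).charpoly).IsRoot x) → ∀ ⦃n : ℕ⦄,
      Valued.v ((((γH.1.val : GL (Fin 2) (UnitaryGroup.LocalRing L v)).val.map (Pi.evalRingHom (fun w' : PlacesOver L v => w'.1.adicCompletion L) w))).trace ^ 2 - 4 * (((γH.1.val : GL (Fin 2) (UnitaryGroup.LocalRing L v)).val.map (Pi.evalRingHom (fun w' : PlacesOver L v => w'.1.adicCompletion L) w))).det) = WithZero.exp (-((2 * (2 * n + 1) : ℕ) : ℤ)) → 1 ≤ n →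
      ∀ (m : ℕ), Valued.v (((finCharpolyTwo L v γH).eval (finGammaTwo L v γH)) w) =
          Valued.v ((toPlace v w (HeckeCharacter.uniformizer ↥(maximalRealSubfield L) v : v.adicCompletion ↥(maximalRealSubfield L))) ^ m) →
        ∀ β : (v.adicCompletion ↥(maximalRealSubfield L))ˣ, toPlace v w (β : v.adicCompletion ↥(maximalRealSubfield L)) =
          -(((finCharpolyTwo L v γH).eval (finGammaTwo L v γH)) w *
              (finGammaTwo L v γH w ^ 2 +
                ((γH.1.val.val : Matrix (Fin 2) (Fin 2) (LocalRing L v)).map (Pi.evalRingHom (fun w' : PlacesOver L v => w'.1.adicCompletion L) w)).det)) /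
            (2 * finGammaTwo L v γH w ^ 2 *
              ((γH.1.val.val : Matrix (Fin 2) (Fin 2) (LocalRing L v)).map (Pi.evalRingHom (fun w' : PlacesOver L v => w'.1.adicCompletion L) w)).det) →
        ∀ (P₁ : GL (Fin 3) (w.1.adicCompletion L)) (d : Fin 2 → (w.1.adicCompletion L)) (η : (w.1.adicCompletion L)) (γ₁ : GL (Fin 2) (w.1.adicCompletion L)),
        P₁ ∈ glInt 3 (w.1.adicCompletion L) →
        formCongr (galAdicCompletionMap (L := L) (IsCMField.complexConj L) hw) P₁ (placeForm (Matrix.of fun i j : Fin 3 => if i.val + j.val + 1 = 3 then (1 : L) else 0) w.1) = !![(Matrix.diagonal d) 0 0, 0, (Matrix.diagonal d) 0 1; 0, η, 0; (Matrix.diagonal d) 1 0, 0, (Matrix.diagonal d) 1 1] →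
        (∀ i, Valued.v (d i) = 1) → (∀ i, (galAdicCompletionMap (L := L) (IsCMField.complexConj L) hw) (d i) = d i) →
        (∀ z : (w.1.adicCompletion L), Valued.v z ≤ 1 → Valued.v (d 0 + d 1 * ((galAdicCompletionMap (L := L) (IsCMField.complexConj L) hw) z * z)) = 1) →
        (∀ z : (w.1.adicCompletion L), Valued.v z ≤ 1 → Valued.v (d 0 * ((galAdicCompletionMap (L := L) (IsCMField.complexConj L) hw) z * z) + d 1) = 1) →
        (galAdicCompletionMap (L := L) (IsCMField.complexConj L) hw) η = η → Valued.v η = 1 →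
        (∀ i j, Valued.v (((γ₁ : Matrix (Fin 2) (Fin 2) (w.1.adicCompletion L)) - 1) i j) ≤ Valued.v (ϖ ^ 2)) →
        γ₁ ∈ unitaryGroupOfForm (galAdicCompletionMap (L := L) (IsCMField.complexConj L) hw) (Matrix.diagonal d) →
        (γ₁ : Matrix (Fin 2) (Fin 2) (w.1.adicCompletion L)).charpoly = (((γH.1.val : GL (Fin 2) (UnitaryGroup.LocalRing L v)).val.map (Pi.evalRingHom (fun w' : PlacesOver L v => w'.1.adicCompletion L) w))).charpoly →
        Valued.v ((γ₁ : Matrix (Fin 2) (Fin 2) (w.1.adicCompletion L)).trace ^ 2 - 4 * (γ₁ : Matrix (Fin 2) (Fin 2) (w.1.adicCompletion L)).det) = WithZero.exp (-((2 * (2 * n + 1) : ℕ) : ℤ)) →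
        (¬ ∃ x : (w.1.adicCompletion L), ((γ₁ : Matrix (Fin 2) (Fin 2) (w.1.adicCompletion L)).charpoly).IsRoot x) →
        (¬ ∃ t : (w.1.adicCompletion L), t * (galAdicCompletionMap (L := L) (IsCMField.complexConj L) hw) t = η) →
          ∀ (k a : ℕ), m = 2 * k + 3 → n = a + k + 1 → m < 2 * n + 1 → ∃ (R NE NhP NhM NaP NaM : ℕ),
          ({M : Submodule (Valued.integer (w.1.adicCompletion L)) (Fin 3 → (w.1.adicCompletion L)) | IsSelfDualLattice (galAdicCompletionMap (L := L) (IsCMField.complexConj L) hw) ϖ (placeForm (Matrix.of fun i j : Fin 3 => if i.val + j.val + 1 = 3 then (1 : L) else 0) w.1) M ∧ mapGL (endoGL (((localNonsplitEquiv (IsCMField.complexConj L) (Matrix.of fun i j : Fin 2 => if i.val + j.val + 1 = 2 then (1 : L) else 0) (IsCMField.complexConj_ne_one L) w hw γH.1).val : GL (Fin 2) (w.1.adicCompletion L)), ((localNonsplitEquiv (IsCMField.complexConj L) (Matrix.of fun i j : Fin 1 => if i.val + j.val + 1 = 1 then (1 : L) else 0) (IsCMField.complexConj_ne_one L) w hw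 γH.2).val : GL (Fin 1) (w.1.adicCompletion L)))) M = M ∧ (M.map ((Matrix.toLin' (((endoGL (((localNonsplitEquiv (IsCMField.complexConj L) (Matrix.of fun i j : Fin 2 => if i.val + j.val + 1 = 2 then (1 : L) else 0) (IsCMField.complexConj_ne_one L) w hw γH.1).val : GL (Fin 2) (w.1.adicCompletion L)), ((localNonsplitEquiv (IsCMField.complexConj L) (Matrix.of fun i j : Fin 1 => if i.val + j.val + 1 = 1 then (1 : L) else 0) (IsCMField.complexConj_ne_one L) w hw γH.2).val : GL (Fin 1) (w.1.adicCompletion L))) : GL (Fin 3) (w.1.adicCompletion L)) : Matrix (Fin 3) (Fin 3) (w.1.adicCompletion L)) - 1)).restrictScalars (Valued.integer (w.1.adicCompletion L))) ≤ scaleLattice ϖ M ∧ ¬ M.map ((Matrix.toLin' (((endoGL (((localNonsplitEquiv (IsCMField.complexConj L) (Matrix.of fun i j : Fin 2 => if i.val + j.val + 1 = 2 then (1 : L) else 0) (IsCMField.complexConj_ne_one L) w hw γH.1).val : GL (Fin 2) (w.1.adicCompletion L)), ((localNonsplitEquiv (IsCMField.complexConj L) (Matrix.of fun i j : Fin 1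 => if i.val + j.val + 1 = 1 then (1 : L) else 0) (IsCMField.complexConj_ne_one L) w hw γH.2).val : GL (Fin 1) (w.1.adicCompletion L))) : GL (Fin 3) (w.1.adicCompletion L)) : Matrix (Fin 3) (Fin 3) (w.1.adicCompletion L)) - 1)).restrictScalars (Valued.integer (w.1.adicCompletion L))) ≤ scaleLattice (ϖ ^ 2) M ∧ M.map ((Matrix.toLin' ((((endoGL (((localNonsplitEquiv (IsCMField.complexConj L) (Matrix.of fun i j : Fin 2 => if i.val + j.val + 1 = 2 then (1 : L) else 0) (IsCMField.complexConj_ne_one L) w hw γH.1).val : GL (Fin 2) (w.1.adicCompletion L)), ((localNonsplitEquiv (IsCMField.complexConj L) (Matrix.of fun i j : Fin 1 => if i.val + j.val + 1 = 1 then (1 : L) else 0) (IsCMField.complexConj_ne_one L) w hw γH.2).val : GL (Fin 1) (w.1.adicCompletion L))) : GL (Fin 3) (w.1.adicCompletion L)) : Matrix (Fin 3) (Fin 3) (w.1.adicCompletion L)) - 1) ^ 2)).restrictScalars (Valued.integer (w.1.adicCompletion L))) ≤ scaleLattice (ϖ ^ 3) M ∧ ∃ y ∈ M, ∃ a : (w.1.adicCompletion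 L), Valued.v a = 1 ∧ Valued.v (ϖ⁻¹ * pairing (galAdicCompletionMap (L := L) (IsCMField.complexConj L) hw) (placeForm (Matrix.of fun i j : Fin 3 => if i.val + j.val + 1 = 3 then (1 : L) else 0) w.1) y ((((endoGL (((localNonsplitEquiv (IsCMField.complexConj L) (Matrix.of fun i j : Fin 2 => if i.val + j.val + 1 = 2 then (1 : L) else 0) (IsCMField.complexConj_ne_one L) w hw γH.1).val : GL (Fin 2) (w.1.adicCompletion L)), ((localNonsplitEquiv (IsCMField.complexConj L) (Matrix.of fun i j : Fin 1 => if i.val + j.val + 1 = 1 then (1 : L) else 0) (IsCMField.complexConj_ne_one L) w hw γH.2).val : GL (Fin 1) (w.1.adicCompletion L))) : GL (Fin 3) (w.1.adicCompletion L)) : Matrix (Fin 3) (Fin 3) (w.1.adicCompletion L)) - 1) *ᵥ y) - c * a ^ 2) < 1)}.ncard : ℂ) =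
            (NhP : ℂ) * (Ideal.absNorm v.asIdeal : ℂ) ^ (2 * k) + (NE : ℂ) * (((Ideal.absNorm v.asIdeal : ℂ) * ((Ideal.absNorm v.asIdeal : ℂ) - 1) / 2) * (Ideal.absNorm v.asIdeal : ℂ) ^ (2 * k) * ∑ i ∈ Finset.range k, (Ideal.absNorm v.asIdeal : ℂ) ^ i) ∧
          ({M : Submodule (Valued.integer (w.1.adicCompletion L)) (Fin 3 → (w.1.adicCompletion L)) | IsSelfDualLattice (galAdicCompletionMap (L := L) (IsCMField.complexConj L) hw) ϖ (placeForm (Matrix.of fun i j : Fin 3 => if i.val + j.val + 1 = 3 then (1 : L) else 0) w.1) M ∧ mapGL (endoGL (((localNonsplitEquiv (IsCMField.complexConj L) (Matrix.of fun i j : Fin 2 => if i.val + j.val + 1 = 2 then (1 : L) else 0) (IsCMField.complexConj_ne_one L) w hw γH.1).val : GL (Fin 2) (w.1.adicCompletion L)), ((localNonsplitEquiv (IsCMField.complexConj L) (Matrix.of fun i j : Fin 1 => if i.val + j.val + 1 = 1 then (1 : L) else 0) (IsCMField.complexConj_ne_one L) w hw γH.2).val : GL (Fin 1) (w.1.adicCompletion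 L)))) M = M ∧ (M.map ((Matrix.toLin' (((endoGL (((localNonsplitEquiv (IsCMField.complexConj L) (Matrix.of fun i j : Fin 2 => if i.val + j.val + 1 = 2 then (1 : L) else 0) (IsCMField.complexConj_ne_one L) w hw γH.1).val : GL (Fin 2) (w.1.adicCompletion L)), ((localNonsplitEquiv (IsCMField.complexConj L) (Matrix.of fun i j : Fin 1 => if i.val + j.val + 1 = 1 then (1 : L) else 0) (IsCMField.complexConj_ne_one L) w hw γH.2).val : GL (Fin 1) (w.1.adicCompletion L))) : GL (Fin 3) (w.1.adicCompletion L)) : Matrix (Fin 3) (Fin 3) (w.1.adicCompletion L)) - 1)).restrictScalars (Valued.integer (w.1.adicCompletion L))) ≤ scaleLattice ϖ M ∧ ¬ M.map ((Matrix.toLin' (((endoGL (((localNonsplitEquiv (IsCMField.complexConj L) (Matrix.of fun i j : Fin 2 => if i.val + j.val + 1 = 2 then (1 : L) else 0) (IsCMField.complexConj_ne_one L) w hw γH.1).val : GL (Fin 2) (w.1.adicCompletion L)), ((localNonsplitEquiv (IsCMField.complexConj L) (Matrix.of fun i j : Fin 1 => if i.val + j.val + 1 = 1 then (1 : L) else 0)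 (IsCMField.complexConj_ne_one L) w hw γH.2).val : GL (Fin 1) (w.1.adicCompletion L))) : GL (Fin 3) (w.1.adicCompletion L)) : Matrix (Fin 3) (Fin 3) (w.1.adicCompletion L)) - 1)).restrictScalars (Valued.integer (w.1.adicCompletion L))) ≤ scaleLattice (ϖ ^ 2) M ∧ M.map ((Matrix.toLin' ((((endoGL (((localNonsplitEquiv (IsCMField.complexConj L) (Matrix.of fun i j : Fin 2 => if i.val + j.val + 1 = 2 then (1 : L) else 0) (IsCMField.complexConj_ne_one L) w hw γH.1).val : GL (Fin 2) (w.1.adicCompletion L)), ((localNonsplitEquiv (IsCMField.complexConj L) (Matrix.of fun i j : Fin 1 => if i.val + j.val + 1 = 1 then (1 : L) else 0) (IsCMField.complexConj_ne_one L) w hw γH.2).val : GL (Fin 1) (w.1.adicCompletion L))) : GL (Fin 3) (w.1.adicCompletion L)) : Matrix (Fin 3) (Fin 3) (w.1.adicCompletion L)) - 1) ^ 2)).restrictScalars (Valued.integer (w.1.adicCompletion L))) ≤ scaleLattice (ϖ ^ 3) M ∧ ¬ ∃ y ∈ M, ∃ a : (w.1.adicCompletion L), Valued.v a = 1 ∧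 Valued.v (ϖ⁻¹ * pairing (galAdicCompletionMap (L := L) (IsCMField.complexConj L) hw) (placeForm (Matrix.of fun i j : Fin 3 => if i.val + j.val + 1 = 3 then (1 : L) else 0) w.1) y ((((endoGL (((localNonsplitEquiv (IsCMField.complexConj L) (Matrix.of fun i j : Fin 2 => if i.val + j.val + 1 = 2 then (1 : L) else 0) (IsCMField.complexConj_ne_one L) w hw γH.1).val : GL (Fin 2) (w.1.adicCompletion L)), ((localNonsplitEquiv (IsCMField.complexConj L) (Matrix.of fun i j : Fin 1 => if i.val + j.val + 1 = 1 then (1 : L) else 0) (IsCMField.complexConj_ne_one L) w hw γH.2).val : GL (Fin 1) (w.1.adicCompletion L))) : GL (Fin 3) (w.1.adicCompletion L)) : Matrix (Fin 3) (Fin 3) (w.1.adicCompletion L)) - 1) *ᵥ y) - c * a ^ 2) < 1)}.ncard : ℂ) =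
            (NhM : ℂ) * (Ideal.absNorm v.asIdeal : ℂ) ^ (2 * k) + (NE : ℂ) * (((Ideal.absNorm v.asIdeal : ℂ) * ((Ideal.absNorm v.asIdeal : ℂ) - 1) / 2) * (Ideal.absNorm v.asIdeal : ℂ) ^ (2 * k) * ∑ i ∈ Finset.range k, (Ideal.absNorm v.asIdeal : ℂ) ^ i) ∧
          ({M : Submodule (Valued.integer (w.1.adicCompletion L)) (Fin 3 → (w.1.adicCompletion L)) | IsSelfDualLattice (galAdicCompletionMap (L := L) (IsCMField.complexConj L) hw) ϖ (placeForm (Matrix.of fun i j : Fin 3 => if i.val + j.val + 1 = 3 then (1 : L) else 0) w.1) M ∧ mapGL (P₁ * endoGL (γ₁, ((localNonsplitEquiv (IsCMField.complexConj L) (Matrix.of fun i j : Fin 1 => if i.val + j.val + 1 = 1 then (1 : L) else 0) (IsCMField.complexConj_ne_one L) w hw γH.2).val : GL (Fin 1) (w.1.adicCompletion L))) * P₁⁻¹) M = M ∧ (M.map ((Matrix.toLin' (((P₁ * endoGL (γ₁, ((localNonsplitEquiv (IsCMField.complexConj L) (Matrix.of fun i j : Fin 1 => if i.val + j.val + 1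 = 1 then (1 : L) else 0) (IsCMField.complexConj_ne_one L) w hw γH.2).val : GL (Fin 1) (w.1.adicCompletion L))) * P₁⁻¹ : GL (Fin 3) (w.1.adicCompletion L)) : Matrix (Fin 3) (Fin 3) (w.1.adicCompletion L)) - 1)).restrictScalars (Valued.integer (w.1.adicCompletion L))) ≤ scaleLattice ϖ M ∧ ¬ M.map ((Matrix.toLin' (((P₁ * endoGL (γ₁, ((localNonsplitEquiv (IsCMField.complexConj L) (Matrix.of fun i j : Fin 1 => if i.val + j.val + 1 = 1 then (1 : L) else 0) (IsCMField.complexConj_ne_one L) w hw γH.2).val : GL (Fin 1) (w.1.adicCompletion L))) * P₁⁻¹ : GL (Fin 3) (w.1.adicCompletion L)) : Matrix (Fin 3) (Fin 3) (w.1.adicCompletion L)) - 1)).restrictScalars (Valued.integer (w.1.adicCompletion L))) ≤ scaleLattice (ϖ ^ 2) M ∧ M.map ((Matrix.toLin' ((((P₁ * endoGL (γ₁, ((localNonsplitEquiv (IsCMField.complexConj L) (Matrix.of fun i j : Fin 1 => if i.val + j.val + 1 = 1 then (1 : L) else 0) (IsCMField.complexConj_ne_one L) w hw γH.2).val : GL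 (Fin 1) (w.1.adicCompletion L))) * P₁⁻¹ : GL (Fin 3) (w.1.adicCompletion L)) : Matrix (Fin 3) (Fin 3) (w.1.adicCompletion L)) - 1) ^ 2)).restrictScalars (Valued.integer (w.1.adicCompletion L))) ≤ scaleLattice (ϖ ^ 3) M ∧ ∃ y ∈ M, ∃ a : (w.1.adicCompletion L), Valued.v a = 1 ∧ Valued.v (ϖ⁻¹ * pairing (galAdicCompletionMap (L := L) (IsCMField.complexConj L) hw) (placeForm (Matrix.of fun i j : Fin 3 => if i.val + j.val + 1 = 3 then (1 : L) else 0) w.1) y ((((P₁ * endoGL (γ₁, ((localNonsplitEquiv (IsCMField.complexConj L) (Matrix.of fun i j : Fin 1 => if i.val + j.val + 1 = 1 then (1 : L) else 0) (IsCMField.complexConj_ne_one L) w hw γH.2).val : GL (Fin 1) (w.1.adicCompletion L))) * P₁⁻¹ : GL (Fin 3) (w.1.adicCompletion L)) : Matrix (Fin 3) (Fin 3) (w.1.adicCompletion L)) - 1) *ᵥ y) - c * a ^ 2) < 1)}.ncard : ℂ) =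
            (NaP : ℂ) * (Ideal.absNorm v.asIdeal : ℂ) ^ (2 * k) ∧
          ({M : Submodule (Valued.integer (w.1.adicCompletion L)) (Fin 3 → (w.1.adicCompletion L)) | IsSelfDualLattice (galAdicCompletionMap (L := L) (IsCMField.complexConj L) hw) ϖ (placeForm (Matrix.of fun i j : Fin 3 => if i.val + j.val + 1 = 3 then (1 : L) else 0) w.1) M ∧ mapGL (P₁ * endoGL (γ₁, ((localNonsplitEquiv (IsCMField.complexConj L) (Matrix.of fun i j : Fin 1 => if i.val + j.val + 1 = 1 then (1 : L) else 0) (IsCMField.complexConj_ne_one L) w hw γH.2).val : GL (Fin 1) (w.1.adicCompletion L))) * P₁⁻¹) M = M ∧ (M.map ((Matrix.toLin' (((P₁ * endoGL (γ₁, ((localNonsplitEquiv (IsCMField.complexConj L) (Matrix.of fun i j : Fin 1 => if i.val + j.val + 1 = 1 then (1 : L) else 0) (IsCMField.complexConj_ne_one L) w hw γH.2).val : GL (Fin 1) (w.1.adicCompletion L))) * P₁⁻¹ : GL (Fin 3) (w.1.adicCompletion L)) : Matrix (Fin 3) (Fin 3) (w.1.adicCompletion L)) - 1)).restrictScalars (Valued.integer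 (w.1.adicCompletion L))) ≤ scaleLattice ϖ M ∧ ¬ M.map ((Matrix.toLin' (((P₁ * endoGL (γ₁, ((localNonsplitEquiv (IsCMField.complexConj L) (Matrix.of fun i j : Fin 1 => if i.val + j.val + 1 = 1 then (1 : L) else 0) (IsCMField.complexConj_ne_one L) w hw γH.2).val : GL (Fin 1) (w.1.adicCompletion L))) * P₁⁻¹ : GL (Fin 3) (w.1.adicCompletion L)) : Matrix (Fin 3) (Fin 3) (w.1.adicCompletion L)) - 1)).restrictScalars (Valued.integer (w.1.adicCompletion L))) ≤ scaleLattice (ϖ ^ 2) M ∧ M.map ((Matrix.toLin' ((((P₁ * endoGL (γ₁, ((localNonsplitEquiv (IsCMField.complexConj L) (Matrix.of fun i j : Fin 1 => if i.val + j.val + 1 = 1 then (1 : L) else 0) (IsCMField.complexConj_ne_one L) w hw γH.2).val : GL (Fin 1) (w.1.adicCompletion L))) * P₁⁻¹ : GL (Fin 3) (w.1.adicCompletion L)) : Matrix (Fin 3) (Fin 3) (w.1.adicCompletion L)) - 1) ^ 2)).restrictScalars (Valued.integer (w.1.adicCompletion L))) ≤ scaleLattice (ϖ ^ 3) M ∧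 ¬ ∃ y ∈ M, ∃ a : (w.1.adicCompletion L), Valued.v a = 1 ∧ Valued.v (ϖ⁻¹ * pairing (galAdicCompletionMap (L := L) (IsCMField.complexConj L) hw) (placeForm (Matrix.of fun i j : Fin 3 => if i.val + j.val + 1 = 3 then (1 : L) else 0) w.1) y ((((P₁ * endoGL (γ₁, ((localNonsplitEquiv (IsCMField.complexConj L) (Matrix.of fun i j : Fin 1 => if i.val + j.val + 1 = 1 then (1 : L) else 0) (IsCMField.complexConj_ne_one L) w hw γH.2).val : GL (Fin 1) (w.1.adicCompletion L))) * P₁⁻¹ : GL (Fin 3) (w.1.adicCompletion L)) : Matrix (Fin 3) (Fin 3) (w.1.adicCompletion L)) - 1) *ᵥ y) - c * a ^ 2) < 1)}.ncard : ℂ) =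
            (NaM : ℂ) * (Ideal.absNorm v.asIdeal : ℂ) ^ (2 * k) ∧
          (R : ℂ) = ((Ideal.absNorm v.asIdeal : ℂ) + 1) * ∑ i ∈ Finset.range a, (Ideal.absNorm v.asIdeal : ℂ) ^ i + (Ideal.absNorm v.asIdeal : ℂ) ^ a ∧ (NE : ℂ) = 2 * (Ideal.absNorm v.asIdeal : ℂ) ^ (a + 1) ∧
          (NhP : ℂ) - (NaP : ℂ) = (((Ideal.absNorm v.asIdeal : ℂ) - 1) * (Ideal.absNorm v.asIdeal : ℂ) * (R : ℂ) - ((Ideal.absNorm v.asIdeal : ℂ) + 1) * (Ideal.absNorm v.asIdeal : ℂ)) / 2 ∧ (NhM : ℂ) - (NaM : ℂ) = (((Ideal.absNorm v.asIdeal : ℂ) - 1) * (Ideal.absNorm v.asIdeal : ℂ) * (R : ℂ) - ((Ideal.absNorm v.asIdeal : ℂ) + 1) * (Ideal.absNorm v.asIdeal : ℂ)) / 2 := by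
  intro c hc hred γH hblk hu2 hreg hirr n hdisc hn m hm β hβ P₁ d η γ₁ hP₁ hform hd hσd han₀ han₁ hση hηv hγ2 hγU hχ hdiscγ hirrγ hηN k a hk ha hg
  obtain ⟨R, NE, P, M, hf, hnf, hR, hNE, hsum, hΛ, hnΛ⟩ := Literature.NumberTheory.Rogawski1990.BlockLawHyp.zhyp_pm_odd_B_ram L H' hH' w hw he hH'w _hH'i h2 ϖ hϖ hσϖ A hA hframe c hc hred hblk hu2 hreg hirr
    hdisc hn m hm β hβ P₁ d η γ₁ hP₁ hform hd hσd han₀ han₁ hση hηv hγ2 hγU hχ hdiscγ hirrγ hηN k a hk ha hg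
  obtain ⟨Pa, Ma, haf, hanf, haΛ, hanΛ⟩ := Literature.NumberTheory.Rogawski1990.BlockLawAniso.zaniso_pm_odd_B_ram L H' hH' w hw he hH'w _hH'i h2 ϖ hϖ hσϖ A hA hframe c hc hred hblk hu2 hreg hirr
    hdisc hn m hm β hβ P₁ d η γ₁ hP₁ hform hd hσd han₀ han₁ hση hηv hγ2 hγU hχ hdiscγ hirrγ hηN k a hk ha hg
  by_cases hflip : (IsSquare (-1 : 𝓀[w.1.adicCompletion L]) ∨ Even k)
  · obtain ⟨h1, h2'⟩ := hf hflip
    obtain ⟨h3, h4⟩ := haf hflip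
    refine ⟨R, NE, P, M, Pa, Ma, h1, h2', h3, h4, hR, hNE, ?_, ?_⟩
    · by_cases hL : (∃ z : (w.1.adicCompletion L), Valued.v z = 1 ∧ Valued.v (((((γH.1.val : GL (Fin 2) (UnitaryGroup.LocalRing L v)).val.map (Pi.evalRingHom (fun w' : PlacesOver L v => w'.1.adicCompletion L) w))).trace - 2 * finGammaTwo L v γH w) / (2 * ϖ ^ m) - c * z ^ 2) < 1)
      · obtain ⟨hPa, hMa⟩ := haΛ hL; have hd := hΛ hL; linear_combination (hsum + hd) / 2 - hPa
      · obtain ⟨hPa, hMa⟩ := hanΛ hL; have hd := hnΛ hL; linear_combination (hsum + hd) / 2 - hPa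
    · by_cases hL : (∃ z : (w.1.adicCompletion L), Valued.v z = 1 ∧ Valued.v (((((γH.1.val : GL (Fin 2) (UnitaryGroup.LocalRing L v)).val.map (Pi.evalRingHom (fun w' : PlacesOver L v => w'.1.adicCompletion L) w))).trace - 2 * finGammaTwo L v γH w) / (2 * ϖ ^ m) - c * z ^ 2) < 1)
      · obtain ⟨hPa, hMa⟩ := haΛ hL; have hd := hΛ hL; linear_combination (hsum - hd) / 2 - hMa
      · obtain ⟨hPa, hMa⟩ := hanΛ hL; have hd := hnΛ hL; linear_combination (hsum - hd) / 2 - hMa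
  · obtain ⟨h1, h2'⟩ := hnf hflip
    obtain ⟨h3, h4⟩ := hanf hflip
    refine ⟨R, NE, M, P, Ma, Pa, h1, h2', h3, h4, hR, hNE, ?_, ?_⟩
    · by_cases hL : (∃ z : (w.1.adicCompletion L), Valued.v z = 1 ∧ Valued.v (((((γH.1.val : GL (Fin 2) (UnitaryGroup.LocalRing L v)).val.map (Pi.evalRingHom (fun w' : PlacesOver L v => w'.1.adicCompletion L) w))).trace - 2 * finGammaTwo L v γH w) / (2 * ϖ ^ m) - c * z ^ 2) < 1)
      · obtain ⟨hPa, hMa⟩ := haΛ hL; have hd := hΛ hL; linear_combination (hsum - hd) / 2 - hMa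
      · obtain ⟨hPa, hMa⟩ := hanΛ hL; have hd := hnΛ hL; linear_combination (hsum - hd) / 2 - hMa
    · by_cases hL : (∃ z : (w.1.adicCompletion L), Valued.v z = 1 ∧ Valued.v (((((γH.1.val : GL (Fin 2) (UnitaryGroup.LocalRing L v)).val.map (Pi.evalRingHom (fun w' : PlacesOver L v => w'.1.adicCompletion L) w))).trace - 2 * finGammaTwo L v γH w) / (2 * ϖ ^ m) - c * z ^ 2) < 1)
      · obtain ⟨hPa, hMa⟩ := haΛ hL; have hd := hΛ hL; linear_combination (hsum + hd) / 2 - hPa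
      · obtain ⟨hPa, hMa⟩ := hanΛ hL; have hd := hnΛ hL; linear_combination (hsum + hd) / 2 - hPa


end Literature.NumberTheory.Rogawski1990.BlockLawPair

end
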